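import Mathlib
import Summits.Ventures.PercRepro2.K5TypedK3Marks
import Summits.Ventures.PercRepro2.K5K3Cert4
import Summits.Ventures.PercRepro2.PMK5LocusFace
import Summits.Ventures.PercRepro2.PMK5LocusZero
import Summits.Ventures.PercRepro2.PMK5LocusG

/-!
# THE EQUALITY LOCUS OF THE CRUX FUNCTIONAL `Gc` ON FIVE-VERTEX BASES — THE ZERO SIDE AND THE TWO «IFF»s
(blind cell PercRepro2, mine-2 g23; on `PMK5LocusG.lean` (the positive side, `RuleG`, `gc_eq_bern`) and the
restricted-table machinery of `PMK5LocusFace.lean`)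

The `G`-degenerate edge sets form a down-set with SEVEN maximal elements `MxG = {503, 637, 700, 926, 1011, 1013, 1014}`
(`coverZG`, one `decide +kernel`); the Kronecker numbers of typer-1's twenty `K₃` tables RESTRICTED to a face
(`kPos3m`, `kNeg3m`) carry the class sums supported inside it digitwise (`kPos3m_eq`, `kNeg3m_eq`,
`cnt3_restr_eq`, `eq_of_kron_eq_KB`), and on each of the seven maximal faces they are EQUAL (`faceG_*`, seven
`decide +kernel`): every coefficient of `Gc` supported inside a degenerate face vanishes (`coefG_eq_of_face`),
whence **`gc_K5_zero_of_face`** (`Gc ≡ 0` on every degenerate face), and the two «iff»s **`gc_K5_pos_iff`**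
(strictly positive on the whole open face ⟺ not degenerate) and **`gc_K5_zero_iff`** (identically zero on the
face ⟺ degenerate).  So on five-vertex bases the crux inequality (HCOV) is tight EXACTLY at the six degenerate
placements of `RuleG` and strict in the interior of every other face.  Standard axioms.
-/

namespace Summit.Ventures.PercRepro2

open Hub CovForm

namespace K5

namespace PM

/-! ## The restricted `K₃` numbers and counts -/

/-- The positive part of `K₃` on the face `m` (`kPos3 4` with restricted tables). -/
def kPos3m (m : ℕ) : ℕ :=
  kp (restr m tPD) (restr m tQ) (restr m (t4p 4)) +
  kp (restr m tQ) (restr m tPDoU) (restr m (t5p 4)) +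
  kp (restr m tPD) (restr m tQ) (restr m (t6m 4)) +
  kp (restr m tPD) (restr m (t7p 4)) (restr m (t7m 0)) +
  kp (restr m tPD) (restr m (t7m 4)) (restr m (t7p 0)) +
  kp (restr m tPDoU) (restr m (t7p 4)) (restr m (t7m 3)) +
  kp (restr m tPDoU) (restr m (t7m 4)) (restr m (t7p 3)) +
  kp (restr m tPD) (restr m (t7p 4)) (restr m t10p) +
  kp (restr m tPD) (restr m (t7m 4)) (restr m t10m) +
  kp (restr m tQ) (restr m (t12 4)) (restr m tPDoU)
/-- The negative part of `K₃` on the face `m` (`kNeg3 4` with restricted tables). -/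
def kNeg3m (m : ℕ) : ℕ :=
  kp (restr m tPD) (restr m tQ) (restr m (t4m 4)) +
  kp (restr m tQ) (restr m tPDoU) (restr m (t5m 4)) +
  kp (restr m tPD) (restr m tQ) (restr m (t6p 4)) +
  kp (restr m tPD) (restr m (t7p 4)) (restr m (t7p 0)) +
  kp (restr m tPD) (restr m (t7m 4)) (restr m (t7m 0)) +
  kp (restr m tPDoU) (restr m (t7p 4)) (restr m (t7p 3)) +
  kp (restr m tPDoU) (restr m (t7m 4)) (restr m (t7m 3)) +
  kp (restr m tPD) (restr m (t7p 4)) (restr m t10m) +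
  kp (restr m tPD) (restr m (t7m 4)) (restr m t10p) +
  kp (restr m tPD) (restr m tQ) (restr m (t11 4))
/-- The positive triple counts of `K₃` on the face `m`. -/
def cntPos3m (m : ℕ) (k : Fin 10 → Fin 4) : ℕ :=
  cnt3 (restr m tPD) (restr m tQ) (restr m (t4p 4)) k +
  cnt3 (restr m tQ) (restr m tPDoU) (restr m (t5p 4)) k +
  cnt3 (restr m tPD) (restr m tQ) (restr m (t6m 4)) k +
  cnt3 (restr m tPD) (restr m (t7p 4)) (restr m (t7m 0)) k +
  cnt3 (restr m tPD) (restr m (t7m 4)) (restr m (t7p 0)) k +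
  cnt3 (restr m tPDoU) (restr m (t7p 4)) (restr m (t7m 3)) k +
  cnt3 (restr m tPDoU) (restr m (t7m 4)) (restr m (t7p 3)) k +
  cnt3 (restr m tPD) (restr m (t7p 4)) (restr m t10p) k +
  cnt3 (restr m tPD) (restr m (t7m 4)) (restr m t10m) k +
  cnt3 (restr m tQ) (restr m (t12 4)) (restr m tPDoU) k
/-- The negative triple counts of `K₃` on the face `m`. -/
def cntNeg3m (m : ℕ) (k : Fin 10 → Fin 4) : ℕ :=
  cnt3 (restr m tPD) (restr m tQ) (restr m (t4m 4)) k +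
  cnt3 (restr m tQ) (restr m tPDoU) (restr m (t5m 4)) k +
  cnt3 (restr m tPD) (restr m tQ) (restr m (t6p 4)) k +
  cnt3 (restr m tPD) (restr m (t7p 4)) (restr m (t7p 0)) k +
  cnt3 (restr m tPD) (restr m (t7m 4)) (restr m (t7m 0)) k +
  cnt3 (restr m tPDoU) (restr m (t7p 4)) (restr m (t7p 3)) k +
  cnt3 (restr m tPDoU) (restr m (t7m 4)) (restr m (t7m 3)) k +
  cnt3 (restr m tPD) (restr m (t7p 4)) (restr m t10m) k +
  cnt3 (restr m tPD) (restr m (t7m 4)) (restr m t10p) k +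
  cnt3 (restr m tPD) (restr m tQ) (restr m (t11 4)) k

/-- `kPos3m` carries the restricted positive counts. -/
lemma kPos3m_eq (m : ℕ) : kPos3m m = ∑ k, cntPos3m m k * KB ^ idx4 k := by
  unfold kPos3m cntPos3m
  simp only [kp_eq]
  rw [sum_add_mul10]
/-- `kNeg3m` carries the restricted negative counts. -/
lemma kNeg3m_eq (m : ℕ) : kNeg3m m = ∑ k, cntNeg3m m k * KB ^ idx4 k := by
  unfold kNeg3m cntNeg3m
  simp only [kp_eq]
  rw [sum_add_mul10]
/-- The restricted positive counts are below `KB` (ten counts `≤ 3^10`). -/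
lemma cntPos3m_lt (m : ℕ) (k : Fin 10 → Fin 4) : cntPos3m m k < KB := by
  unfold cntPos3m
  rw [KB_val]
  have := cnt3_le (restr m tPD) (restr m tQ) (restr m (t4p 4)) k
  have := cnt3_le (restr m tQ) (restr m tPDoU) (restr m (t5p 4)) k
  have := cnt3_le (restr m tPD) (restr m tQ) (restr m (t6m 4)) k
  have := cnt3_le (restr m tPD) (restr m (t7p 4)) (restr m (t7m 0)) k
  have := cnt3_le (restr m tPD) (restr m (t7m 4)) (restr m (t7p 0)) k
  have := cnt3_le (restr m tPDoU) (restr m (t7p 4)) (restr m (t7m 3)) k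
  have := cnt3_le (restr m tPDoU) (restr m (t7m 4)) (restr m (t7p 3)) k
  have := cnt3_le (restr m tPD) (restr m (t7p 4)) (restr m t10p) k
  have := cnt3_le (restr m tPD) (restr m (t7m 4)) (restr m t10m) k
  have := cnt3_le (restr m tQ) (restr m (t12 4)) (restr m tPDoU) k
  omega
/-- The restricted negative counts are below `KB`. -/
lemma cntNeg3m_lt (m : ℕ) (k : Fin 10 → Fin 4) : cntNeg3m m k < KB := by
  unfold cntNeg3m
  rw [KB_val]
  have := cnt3_le (restr m tPD) (restr m tQ) (restr m (t4m 4)) k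
  have := cnt3_le (restr m tQ) (restr m tPDoU) (restr m (t5m 4)) k
  have := cnt3_le (restr m tPD) (restr m tQ) (restr m (t6p 4)) k
  have := cnt3_le (restr m tPD) (restr m (t7p 4)) (restr m (t7p 0)) k
  have := cnt3_le (restr m tPD) (restr m (t7m 4)) (restr m (t7m 0)) k
  have := cnt3_le (restr m tPDoU) (restr m (t7p 4)) (restr m (t7p 3)) k
  have := cnt3_le (restr m tPDoU) (restr m (t7m 4)) (restr m (t7m 3)) k
  have := cnt3_le (restr m tPD) (restr m (t7p 4)) (restr m t10m) k
  have := cnt3_le (restr m tPD) (restr m (t7m 4)) (restr m t10p) k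
  have := cnt3_le (restr m tPD) (restr m tQ) (restr m (t11 4)) k
  omega

/-- **Equal Kronecker numbers have equal digits**, `KB`-bounded version. -/
theorem eq_of_kron_eq_KB (a b : (Fin 10 → Fin 4) → ℕ) (ha : ∀ k, a k < KB) (hb : ∀ k, b k < KB)
    {P M : ℕ} (hP : P = ∑ k, a k * KB ^ idx4 k) (hM : M = ∑ k, b k * KB ^ idx4 k) (h : P = M)
    (k : Fin 10 → Fin 4) : a k = b k := by
  have hKB : 2 ≤ KB := by rw [KB_eq]; norm_num
  have hj : idx4 k < 4 ^ 10 := lt_of_lt_of_eq (idx4_lt k) (by norm_num)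
  have hPa : P / KB ^ idx4 k % KB = a (decode4 (idx4 k)) := by
    rw [hP, sum_profiles_eq]
    exact digit_sum hKB (fun j => a (decode4 j)) (4 ^ 10) (fun j _ => ha _) _ hj
  have hMb : M / KB ^ idx4 k % KB = b (decode4 (idx4 k)) := by
    rw [hM, sum_profiles_eq]
    exact digit_sum hKB (fun j => b (decode4 j)) (4 ^ 10) (fun j _ => hb _) _ hj
  rw [decode4_idx4] at hPa hMb
  rw [← hPa, ← hMb, h]

/-! ## The seven maximal `G`-degenerate faces (kernel) -/

set_option maxRecDepth 100000 in
/-- The restricted numbers of `K₃` agree on the face `503` = {oa1 oa2 oa3 a1a2 a1a3 a1b a2a3 a2b}. -/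
theorem faceG_503 : kPos3m 503 = kNeg3m 503 := by
  decide +kernel

set_option maxRecDepth 100000 in
/-- The restricted numbers of `K₃` agree on the face `637` = {oa1 oa3 ob a1a2 a1a3 a1b a3b}. -/
theorem faceG_637 : kPos3m 637 = kNeg3m 637 := by
  decide +kernel

set_option maxRecDepth 100000 in
/-- The restricted numbers of `K₃` agree on the face `700` = {oa3 ob a1a2 a1a3 a2a3 a3b}. -/
theorem faceG_700 : kPos3m 700 = kNeg3m 700 := by
  decide +kernel

set_option maxRecDepth 100000 in
/-- The restricted numbers of `K₃` agree on the face `926` = {oa2 oa3 ob a1a2 a2a3 a2b a3b}. -/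
theorem faceG_926 : kPos3m 926 = kNeg3m 926 := by
  decide +kernel

set_option maxRecDepth 100000 in
/-- The restricted numbers of `K₃` agree on the face `1011` = {oa1 oa2 a1a2 a1a3 a1b a2a3 a2b a3b}. -/
theorem faceG_1011 : kPos3m 1011 = kNeg3m 1011 := by
  decide +kernel

set_option maxRecDepth 100000 in
/-- The restricted numbers of `K₃` agree on the face `1013` = {oa1 oa3 a1a2 a1a3 a1b a2a3 a2b a3b}. -/
theorem faceG_1013 : kPos3m 1013 = kNeg3m 1013 := by
  decide +kernel

set_option maxRecDepth 100000 in
/-- The restricted numbers of `K₃` agree on the face `1014` = {oa2 oa3 a1a2 a1a3 a1b a2a3 a2b a3b}. -/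
theorem faceG_1014 : kPos3m 1014 = kNeg3m 1014 := by
  decide +kernel

/-- **Every coefficient of `Gc` supported inside a face with equal restricted numbers vanishes.** -/
theorem coefG_eq_of_face (m : ℕ) (hz : kPos3m m = kNeg3m m) (k : Fin 10 → Fin 4)
    (hk : ∀ e : Fin 10, k e ≠ 0 → m.testBit e = true) : cntPos3 4 k = cntNeg3 4 k := by
  have h := eq_of_kron_eq_KB _ _ (cntPos3m_lt m) (cntNeg3m_lt m) (kPos3m_eq m) (kNeg3m_eq m) hz k
  unfold cntPos3m cntNeg3m at h
  simp only [cnt3_restr_eq hk] at h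
  unfold cntPos3 cntNeg3
  omega

/-- The seven maximal `G`-degenerate edge sets. -/
def MxG : Fin 7 → ℕ := ![503, 637, 700, 926, 1011, 1013, 1014]

set_option maxRecDepth 100000 in
/-- **Every `G`-degenerate edge set lies inside one of the seven maximal ones.** -/
theorem coverZG : ∀ m : Fin 1024, RuleG m = true →
    ∃ i : Fin 7, ∀ e : Fin 10, (m : ℕ).testBit e = true → (MxG i).testBit e = true := by
  decide +kernel

/-- The restricted numbers agree on each maximal `G`-degenerate face. -/
theorem faceG_all : ∀ i : Fin 7, kPos3m (MxG i) = kNeg3m (MxG i) := by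
  intro i
  fin_cases i
  exacts [faceG_503, faceG_637, faceG_700, faceG_926, faceG_1011, faceG_1013, faceG_1014]

section Face

variable {R : Type*} [Field R] [LinearOrder R] [IsStrictOrderedRing R]

/-- **THE EQUALITY LOCUS OF THE CRUX FUNCTIONAL — THE ZERO SIDE**: on every `G`-degenerate edge set `m`,
`Gc p ends5 0 1 2 3 4 = 0` at every weight vector supported on `m`. -/
theorem gc_K5_zero_of_face (m : ℕ) (hm : m < 1024) (hr : RuleG m = true) (p : Fin 10 → R)
    (hp₀ : ∀ e : Fin 10, m.testBit e = false → p e = 0) : Gc p ends5 0 1 2 3 4 = 0 := by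
  rw [gc_eq_bern]
  refine Finset.sum_eq_zero fun k _ => ?_
  by_cases hk : ∀ e : Fin 10, k e ≠ 0 → m.testBit e = true
  · obtain ⟨i, hi⟩ := coverZG ⟨m, hm⟩ hr
    have hc := coefG_eq_of_face (MxG i) (faceG_all i) k fun e he => hi e (hk e he)
    rw [hc, sub_self, mul_zero]
  · obtain ⟨e, he⟩ := not_forall.1 hk
    obtain ⟨hke, hme⟩ := Classical.not_imp.1 he
    have hpe : p e = 0 := hp₀ e (by simpa using hme)
    have hb : bern p k = 0 := by
      unfold bern
      apply Finset.prod_eq_zero (Finset.mem_univ e)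
      rw [hpe, zero_pow (fun h => hke (Fin.ext (by simpa using h)))]
      simp
    rw [hb, zero_mul]

/-- **THE EQUALITY LOCUS OF (HCOV) ON FIVE-VERTEX BASES, FIRST «IFF»**: `Gc > 0` at every weight vector
interior on `m` ⟺ `m` is not `G`-degenerate. -/
theorem gc_K5_pos_iff (m : ℕ) (hm : m < 1024) :
    (∀ p : Fin 10 → R, (∀ e : Fin 10, m.testBit e = true → 0 < p e ∧ p e < 1) →
      (∀ e : Fin 10, m.testBit e = false → p e = 0) → 0 < Gc p ends5 0 1 2 3 4) ↔ RuleG m = false := by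
  constructor
  · intro h
    rcases Bool.eq_false_or_eq_true (RuleG m) with hr | hr
    · exfalso
      have hpos := h (centre (R := R) m) (fun e he => centre_on_pos he) (fun e he => centre_off he)
      have hzero := gc_K5_zero_of_face m hm hr (centre (R := R) m) (fun e he => centre_off he)
      rw [hzero] at hpos
      exact lt_irrefl _ hpos
    · exact hr
  · intro hr p hp₁ hp₀
    exact gc_K5_pos_of_face m hm hr p hp₁ hp₀

/-- **THE EQUALITY LOCUS OF (HCOV) ON FIVE-VERTEX BASES, SECOND «IFF»**: `Gc = 0` at every admissible weight
vector supported on `m` ⟺ `m` is `G`-degenerate. -/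
theorem gc_K5_zero_iff (m : ℕ) (hm : m < 1024) :
    (∀ p : Fin 10 → R, (∀ e : Fin 10, 0 ≤ p e ∧ p e ≤ 1) →
      (∀ e : Fin 10, m.testBit e = false → p e = 0) → Gc p ends5 0 1 2 3 4 = 0) ↔ RuleG m = true := by
  constructor
  · intro h
    rcases Bool.eq_false_or_eq_true (RuleG m) with hr | hr
    · exact hr
    · exfalso
      have hpos := gc_K5_pos_of_face m hm hr (centre (R := R) m)
        (fun e he => centre_on_pos he) (fun e he => centre_off he)
      have hzero := h (centre (R := R) m) (centre_01 m) (fun e he => centre_off he)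
      rw [hzero] at hpos
      exact lt_irrefl _ hpos
  · intro hr p _ hp₀
    exact gc_K5_zero_of_face m hm hr p hp₀

end Face

end PM

end K5

end Summit.Ventures.PercRepro2
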